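import Mathlib.MeasureTheory.Constructions.HaarToSphere
import Mathlib.MeasureTheory.Measure.Lebesgue.VolumeOfBalls
import Mathlib.MeasureTheory.Integral.IntegralEqImproper
import Literature.Geometry.Lorentzian.KerrCylinderFamilyExpansion
import Literature.Geometry.Lorentzian.SchwarzschildCylinderCommutators
import Literature.Geometry.Lorentzian.InteriorKerrGluingParameters
import Literature.Geometry.Lorentzian.InitialDataInterpolation
import Literature.Analysis.FluidPDE.EyinkBalanceLimits
import HarnessLib

/-!
# The first-order obstruction of Li–Mei's interior Kerr gluing is `(8π δm, −8πM b⃗)`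

Support file (all results proved; no named facts) for the named fact `LiMei.interiorKerrGluing`
(`InteriorKerrGluing.lean`; J. Li, H. Mei, *A construction of collapsing spacetimes in vacuum*,
Comm. Math. Phys. 378 (2020) = arXiv:2005.01249, Prop. 4.1), Step S5 of the architecture recorded
in `InteriorKerrGluingReduction.lean`: Li–Mei p. 25, "a direct computation shows
`𝓘(m, a⃗) = (8π(m − m₀), −8π m₀ a⃗) + (ε₀, ε₁, ε₂, ε₃) + O(ε²)`".

The obstruction `𝓘_α(p)` is the `L²(√g₀ dy)`-pairing of the momentum constraint of the glued datum
with the cut-off Killing initial data `χ X_α` of the Schwarzschild cylinder `(G₀, K₀) = (ḡ_M, k̄_M)`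
(Li–Mei (4.1); `X_0 = ∂_t = y/‖y‖`, `X_i = Ω_i = e_i × ·`), `χ = χ₀ ∘ ‖·‖` a radial cut-off equal to
`1` on the deformation shell. Its part LINEAR in the variation `(γ, κ)` of the data is
`∫ √g₀ (⟨γ, DM*_γ(χX)⟩ + ⟨κ, DM*_κ(χX)⟩) dy` (Green's identity,
`CoordMomentumPairingIntegral.lean`), and at the Schwarzschild cylinder the paired commutators are
explicit (`SchwarzschildCylinderCommutators.lean`):
`⟨γ, DM*_γ(χ∂_t)⟩ = χ₀'((M − r₀)/(2r₀²√A))(ρ²/r₀²) T(γ)`, `⟨κ, DM*_κ(χ∂_t)⟩ = χ₀'(ρ²/r₀²) T(κ)`,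
`⟨γ, DM*_γ(χΩ)⟩ = −χ₀'/(r₀√Aρ) γ(Ωy, y)`, `⟨κ, DM*_κ(χΩ)⟩ = −χ₀'/(ρA) κ(Ωy, y)`, with
`T(β) = Σᵢ β(eᵢ,eᵢ) − β(y,y)/ρ²`, `A = 2M/r₀ − 1`, `ρ = ‖y‖`, `√g₀ = √A r₀²/ρ²`.

This file evaluates these integrands on the FIRST-ORDER variation in the parameters
`p = (δm, b⃗)` of the Kerr cylinder family `(m, a, R) = (M + δm, ‖b⃗‖, spinIsometry b⃗)`
(`KerrCylinderFamilyExpansion.lean`), packaged here as continuous bilinear forms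

* `LiMei.firstOrderH M r₀ p y = δm (2/r₀) dt² − (2M/(r₀ρ³))(b·(y × ·) ⊗ ⟨y,·⟩ + ⟨y,·⟩ ⊗ b·(y × ·))`,
* `LiMei.firstOrderK M r₀ p y = δm ∂_m k̄_M − (M√A/(r₀²ρ³))(…same spin tensor…)`,

and integrates over `E3`:

* pointwise (`LiMei.timeIntegrand_firstOrder_eq`, `LiMei.rotIntegrand_firstOrder_eq`):
  the `∂_t`-integrand is `−2 δm χ₀'(ρ)/ρ²` and the `Ω_ω`-integrand is
  `3M χ₀'(ρ)/ρ² (⟨b,ω⟩ − ⟨b,ŷ⟩⟨ŷ,ω⟩)`;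
* radially (`LiMei.integral_fun_norm_div_norm_sq`: `∫_{E3} f(‖y‖)/‖y‖² dy = 4π ∫₀^∞ f`;
  `LiMei.integral_Ioi_deriv_cutoffProfile`: `∫₀^∞ χ₀' = −1` for a `C¹` profile equal to `1` on
  `|r| ≤ s₁` and to `0` on `s₂ ≤ |r|`; the angular second moment
  `∫ k(‖y‖)⟨b,ŷ⟩⟨ŷ,ω⟩ = ⅓ (∫ k) ⟨b,ω⟩` is `EyinkBalanceLimits`'
  `integral_radial_mul_inner_unit_mul_inner_unit`);
* in total (`LiMei.integral_timeIntegrand_firstOrder`, `LiMei.integral_rotIntegrand_firstOrder`):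
  **`∫ (∂_t-integrand) = 8π δm`** and **`∫ (Ω_ω-integrand) = −8πM ⟨b⃗, ω⟩`**, i.e. the components of
  `LiMei.obstructionLinear M p = (8π δm, −8πM b⃗)` (`LiMei.obstructionLinear_eq_integrals`).

The radial profile of the tree's cut-off `radialCutoff s₁ s₂` (`InitialDataInterpolation.lean`) is
`radialCutoff s₁ s₂ : ℝ → ℝ` itself (`LiMei.radialCutoff_eq_radialCutoff_norm`), and it satisfies the
profile hypotheses (`LiMei.radialCutoff_real_of_abs_le`, `LiMei.radialCutoff_real_of_le_abs`).

## References

* J. Li, H. Mei, arXiv:2005.01249, §4, proof of Prop. 4.1, pp. 23–25 (key `LiMei2020`).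
* G. L. Eyink, Nonlinearity 16 (2003), §2 (the angular average `∫ φ ℓ̂⊗ℓ̂ = ⅓`; key `Eyink2003`).
-/

noncomputable section

open Set Filter Function Metric MeasureTheory
open scoped Topology RealInnerProductSpace Real

namespace Literature.Geometry.Lorentzian

namespace LiMei

/-! ### The cross product and the rotation generators on `E3` -/

/-- The cross product `ω × y` as a vector of `E3`. [folklore] -/
def crossVec (ω y : E3) : E3 := WithLp.toLp 2 (crossProduct (WithLp.ofLp ω) (WithLp.ofLp y))

/-- Components of `ω × y`. [folklore] -/
theorem crossVec_apply_zero (ω y : E3) : crossVec ω y 0 = ω 1 * y 2 - ω 2 * y 1 := by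
  simp [crossVec, cross_apply]

/-- Components of `ω × y`. [folklore] -/
theorem crossVec_apply_one (ω y : E3) : crossVec ω y 1 = ω 2 * y 0 - ω 0 * y 2 := by
  simp [crossVec, cross_apply]

/-- Components of `ω × y`. [folklore] -/
theorem crossVec_apply_two (ω y : E3) : crossVec ω y 2 = ω 0 * y 1 - ω 1 * y 0 := by
  simp [crossVec, cross_apply]

/-- **`⟪b × y, v⟫ = b·(y × v)`**: the triple product as a covector in its last slot. [folklore] -/
theorem inner_crossVec_left (b y v : E3) : ⟪crossVec b y, v⟫ = triple b y v := by
  have hi : ∀ a u : E3, ⟪a, u⟫ = a 0 * u 0 + a 1 * u 1 + a 2 * u 2 := fun a u ↦ by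
    rw [PiLp.inner_apply, Fin.sum_univ_three]; simp [mul_comm]
  rw [hi, triple_eq, crossVec_apply_zero, crossVec_apply_one, crossVec_apply_two]
  ring

/-- `ω × y` is orthogonal to `y`. [folklore] -/
theorem inner_crossVec_right_self (ω y : E3) : ⟪crossVec ω y, y⟫ = 0 := by
  rw [inner_crossVec_left, triple_eq]
  ring

/-- **`b·(y × (ω × y)) = ‖y‖²⟨b, ω⟩ − ⟨b, y⟩⟨y, ω⟩`** (the `bac − cab` rule). [folklore] -/
theorem triple_crossVec_self (b ω y : E3) :
    triple b y (crossVec ω y) = ‖y‖ ^ 2 * ⟪b, ω⟫ - ⟪b, y⟫ * ⟪y, ω⟫ := by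
  have hi : ∀ a u : E3, ⟪a, u⟫ = a 0 * u 0 + a 1 * u 1 + a 2 * u 2 := fun a u ↦ by
    rw [PiLp.inner_apply, Fin.sum_univ_three]; simp [mul_comm]
  have hn : ‖y‖ ^ 2 = y 0 ^ 2 + y 1 ^ 2 + y 2 ^ 2 := by
    rw [EuclideanSpace.real_norm_sq_eq, Fin.sum_univ_three]
  rw [triple_eq, crossVec_apply_zero, crossVec_apply_one, crossVec_apply_two, hn, hi, hi, hi]
  ring

/-- **The rotation generator `Ω_ω = ω × ·`** as a continuous linear map of `E3`. [folklore] -/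
def crossCLM (ω : E3) : E3 →L[ℝ] E3 :=
  LinearMap.toContinuousLinearMap
    ((WithLp.linearEquiv 2 ℝ (Fin 3 → ℝ)).symm.toLinearMap ∘ₗ
      (crossProduct (WithLp.ofLp ω)) ∘ₗ (WithLp.linearEquiv 2 ℝ (Fin 3 → ℝ)).toLinearMap)

/-- `Ω_ω y = ω × y`. [folklore] -/
@[simp]
theorem crossCLM_apply (ω y : E3) : crossCLM ω y = crossVec ω y := rfl

/-- **`Ω_ω` is skew-adjoint**: `⟪Ω_ω u, u'⟫ = −⟪u, Ω_ω u'⟫`. [folklore] -/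
theorem inner_crossCLM_skew (ω u u' : E3) : ⟪crossCLM ω u, u'⟫ = -⟪u, crossCLM ω u'⟫ := by
  rw [crossCLM_apply, crossCLM_apply, real_inner_comm (crossVec ω u') u, inner_crossVec_left,
    inner_crossVec_left, triple_eq, triple_eq]
  ring

/-- The covector `v ↦ b·(y × v) = ⟪b × y, v⟫`. [folklore] -/
def tripleCovec (b y : E3) : E3 →L[ℝ] ℝ := E3.covec (crossVec b y)

/-- `tripleCovec b y v = b·(y × v)`. [folklore] -/
@[simp]
theorem tripleCovec_apply (b y v : E3) : tripleCovec b y v = triple b y v := by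
  rw [tripleCovec, E3.covec_apply, inner_crossVec_left]

/-- `b·(y × y) = 0`. [folklore] -/
theorem triple_self_right (b y : E3) : triple b y y = 0 := by
  rw [triple_eq]; ring

/-- `Σᵢ yᵢ b·(y × eᵢ) = b·(y × y) = 0`. [folklore] -/
theorem sum_coord_mul_triple_single (b y : E3) :
    ∑ i, y i * triple b y (EuclideanSpace.single i 1) = 0 := by
  rw [Fin.sum_univ_three, triple_eq, triple_eq, triple_eq]
  simp only [PiLp.single_apply]
  simp only [Fin.isValue, ↓reduceIte, Fin.reduceEq]
  ring

/-- `Σᵢ ⟪y, eᵢ⟫² = ‖y‖²` written with coordinates: `Σᵢ yᵢ² = ‖y‖²`. [folklore] -/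
theorem sum_coord_sq (y : E3) : ∑ i, y i ^ 2 = ‖y‖ ^ 2 := by
  rw [EuclideanSpace.real_norm_sq_eq]

/-- `⟪y, eᵢ⟫ = yᵢ`. [folklore] -/
theorem inner_single_one_right (y : E3) (i : Fin 3) : ⟪y, EuclideanSpace.single i 1⟫ = y i := by
  rw [EuclideanSpace.inner_single_right]; simp

/-- `⟪eᵢ, eᵢ⟫ = 1`. [folklore] -/
theorem inner_single_one_self (i : Fin 3) :
    ⟪(EuclideanSpace.single i 1 : E3), EuclideanSpace.single i 1⟫ = 1 := by
  rw [EuclideanSpace.inner_single_left]; simp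

/-! ### The first-order variation of the Kerr cylinder family -/

/-- **The first-order variation of the metric of the Kerr cylinder family** at the Schwarzschild
cylinder, in the parameters `p = (δm, b⃗)`:
`δm (2/r₀) ⟨y,·⟩⊗⟨y,·⟩/ρ² − (2M/(r₀ρ³)) (b·(y × ·) ⊗ ⟨y,·⟩ + ⟨y,·⟩ ⊗ b·(y × ·))`
(Li–Mei (4.2) to first order, cf. `exists_abs_cylH_family_le`). [cite: LiMei2020, (4.2) and p. 25] -/
def firstOrderH (M r₀ : ℝ) (p : ℝ × E3) (y : E3) : E3 →L[ℝ] E3 →L[ℝ] ℝ :=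
  (p.1 * (2 / r₀) / ‖y‖ ^ 2) • (E3.covec y).smulRight (E3.covec y) -
    (2 * M / (r₀ * ‖y‖ ^ 3)) •
      ((tripleCovec p.2 y).smulRight (E3.covec y) + (E3.covec y).smulRight (tripleCovec p.2 y))

/-- The first-order metric variation, evaluated. [cite: LiMei2020, (4.2) and p. 25] -/
theorem firstOrderH_apply (M r₀ : ℝ) (p : ℝ × E3) (y v w : E3) :
    firstOrderH M r₀ p y v w =
      p.1 * (2 / r₀ * (⟪y, v⟫ * ⟪y, w⟫ / ‖y‖ ^ 2)) -
        2 * M / (r₀ * ‖y‖ ^ 3) * (triple p.2 y v * ⟪y, w⟫ + ⟪y, v⟫ * triple p.2 y w) := by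
  simp only [firstOrderH, sub_apply, add_apply, smul_apply, ContinuousLinearMap.smulRight_apply,
    E3.covec_apply, tripleCovec_apply, smul_eq_mul]
  ring

/-- The first-order metric variation is symmetric. [cite: LiMei2020, (4.2)] -/
theorem firstOrderH_symm (M r₀ : ℝ) (p : ℝ × E3) (y v w : E3) :
    firstOrderH M r₀ p y v w = firstOrderH M r₀ p y w v := by
  rw [firstOrderH_apply, firstOrderH_apply]; ring

/-- **The first-order variation of the second fundamental form of the Kerr cylinder family** at the
Schwarzschild cylinder (`0 < r₀ < 2M`, `A = 2M/r₀ − 1`), in `p = (δm, b⃗)`: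
`δm [(√A/r₀² + M/(r₀³√A)) ⟨y,·⟩⊗⟨y,·⟩/ρ² − (1/(√Aρ²))(δ − ⟨y,·⟩⊗⟨y,·⟩/ρ²)]
 − (M√A/(r₀²ρ³)) (b·(y × ·) ⊗ ⟨y,·⟩ + ⟨y,·⟩ ⊗ b·(y × ·))` (cf. `exists_abs_cylK_family_le`).
[cite: LiMei2020, (4.2) and p. 25] -/
def firstOrderK (M r₀ : ℝ) (p : ℝ × E3) (y : E3) : E3 →L[ℝ] E3 →L[ℝ] ℝ :=
  (p.1 * ((Real.sqrt (2 * M / r₀ - 1) / r₀ ^ 2 + M / (r₀ ^ 3 * Real.sqrt (2 * M / r₀ - 1))) /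
      ‖y‖ ^ 2 + 1 / (Real.sqrt (2 * M / r₀ - 1) * ‖y‖ ^ 2) / ‖y‖ ^ 2)) •
      (E3.covec y).smulRight (E3.covec y) -
    (p.1 * (1 / (Real.sqrt (2 * M / r₀ - 1) * ‖y‖ ^ 2))) • E3.delta -
    (M * Real.sqrt (2 * M / r₀ - 1) / (r₀ ^ 2 * ‖y‖ ^ 3)) •
      ((tripleCovec p.2 y).smulRight (E3.covec y) + (E3.covec y).smulRight (tripleCovec p.2 y))

/-- The first-order variation of the second fundamental form, evaluated (the expression of
`exists_abs_cylK_family_le`). [cite: LiMei2020, (4.2) and p. 25] -/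
theorem firstOrderK_apply (M r₀ : ℝ) (p : ℝ × E3) (y v w : E3) :
    firstOrderK M r₀ p y v w =
      p.1 * ((Real.sqrt (2 * M / r₀ - 1) / r₀ ^ 2 + M / (r₀ ^ 3 * Real.sqrt (2 * M / r₀ - 1))) *
            (⟪y, v⟫ * ⟪y, w⟫ / ‖y‖ ^ 2) -
          1 / (Real.sqrt (2 * M / r₀ - 1) * ‖y‖ ^ 2) * (⟪v, w⟫ - ⟪y, v⟫ * ⟪y, w⟫ / ‖y‖ ^ 2)) -
        M * Real.sqrt (2 * M / r₀ - 1) / (r₀ ^ 2 * ‖y‖ ^ 3) *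
          (triple p.2 y v * ⟪y, w⟫ + ⟪y, v⟫ * triple p.2 y w) := by
  simp only [firstOrderK, sub_apply, add_apply, smul_apply, ContinuousLinearMap.smulRight_apply,
    E3.covec_apply, E3.delta_apply, tripleCovec_apply, smul_eq_mul]
  ring

/-- The first-order variation of the second fundamental form is symmetric. [cite: LiMei2020, (4.2)] -/
theorem firstOrderK_symm (M r₀ : ℝ) (p : ℝ × E3) (y v w : E3) :
    firstOrderK M r₀ p y v w = firstOrderK M r₀ p y w v := by
  rw [firstOrderK_apply, firstOrderK_apply, real_inner_comm v w]; ring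

/-! ### The family bounds in terms of `firstOrderH`, `firstOrderK` -/

/-- **`|H[M + δm, ‖b‖, R_b](y)(v,w) − G₀(y)(v,w) − firstOrderH(p)(y)(v,w)| ≤ C (|δm| + ‖b‖)²`**
uniformly on `ρ₁ < ‖y‖ < ρ₂` (`ρ₁ ≥ 1`) and unit `v, w`, where `G₀ = cylH M 0 r₀ τ₀ R_b` is the
Schwarzschild cylinder metric (independent of the frame `R_b`). [cite: LiMei2020, p. 25] -/
theorem exists_abs_cylH_sub_sub_firstOrderH_le (M : ℝ) {r₀ : ℝ} (hr₀ : 0 < r₀) {ρ₁ : ℝ}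
    (hρ₁ : 1 ≤ ρ₁) (ρ₂ τ₀ : ℝ) :
    ∃ C : ℝ, 0 ≤ C ∧ ∀ p : ℝ × E3, |p.1| + ‖p.2‖ ≤ 1 → ∀ (v w : E3), ‖v‖ ≤ 1 → ‖w‖ ≤ 1 →
      ∀ y : E3, ρ₁ < ‖y‖ → ‖y‖ < ρ₂ →
        |cylH (M + p.1) ‖p.2‖ r₀ τ₀ (spinIsometry p.2) y v w -
            cylH M 0 r₀ τ₀ (spinIsometry p.2) y v w - firstOrderH M r₀ p y v w| ≤
          C * (|p.1| + ‖p.2‖) ^ 2 := by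
  obtain ⟨C, hC0, hC⟩ := exists_abs_cylH_family_le M hr₀ hρ₁ ρ₂ τ₀
  refine ⟨C, hC0, fun p hp v w hv hw y hy₁ hy₂ ↦ ?_⟩
  have h := hC p hp v w hv hw y hy₁ hy₂
  rw [cylH_zero_spin_apply hr₀ τ₀ (spinIsometry p.2) (hρ₁.trans hy₁.le) v w, firstOrderH_apply]
  convert h using 2
  ring

/-- **`|K[M + δm, ‖b‖, R_b](y)(v,w) − K₀(y)(v,w) − firstOrderK(p)(y)(v,w)| ≤ C (|δm| + ‖b‖)²** for
`|δm| + ‖b‖ ≤ δ`, uniformly on `ρ₁ < ‖y‖ < ρ₂` (`ρ₁ ≥ 1`) and unit `v, w` (`0 < r₀ < 2M`).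
[cite: LiMei2020, p. 25] -/
theorem exists_abs_cylK_sub_sub_firstOrderK_le [Kerr.Facts] {M r₀ : ℝ} (hr₀ : 0 < r₀)
    (h2M : r₀ < 2 * M) {ρ₁ : ℝ} (hρ₁ : 1 ≤ ρ₁) (ρ₂ τ₀ : ℝ) :
    ∃ δ C : ℝ, 0 < δ ∧ 0 ≤ C ∧ ∀ p : ℝ × E3, |p.1| + ‖p.2‖ ≤ δ → ∀ (v w : E3), ‖v‖ ≤ 1 → ‖w‖ ≤ 1 →
      ∀ y : E3, ρ₁ < ‖y‖ → ‖y‖ < ρ₂ →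
        |cylK (M + p.1) ‖p.2‖ hr₀ τ₀ (spinIsometry p.2) y v w -
            cylK M 0 hr₀ τ₀ (spinIsometry p.2) y v w - firstOrderK M r₀ p y v w| ≤
          C * (|p.1| + ‖p.2‖) ^ 2 := by
  obtain ⟨δ, C, hδ, hC0, hC⟩ := exists_abs_cylK_family_le hr₀ h2M hρ₁ ρ₂ τ₀
  refine ⟨δ, C, hδ, hC0, fun p hp v w hv hw y hy₁ hy₂ ↦ ?_⟩
  have h := hC p hp v w hv hw y hy₁ hy₂
  rw [cylK_zero_spin_apply hr₀ h2M τ₀ (spinIsometry p.2) (lt_of_le_of_lt hρ₁ hy₁) v w,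
    firstOrderK_apply]
  convert h using 2
  ring

/-! ### Pointwise evaluation of the paired commutators on the first-order variation -/

/-- `fH(y, y) = δm (2/r₀) ρ²`. [cite: LiMei2020, p. 25] -/
theorem firstOrderH_apply_self (M r₀ : ℝ) (p : ℝ × E3) {y : E3} (hy : y ≠ 0) :
    firstOrderH M r₀ p y y y = p.1 * (2 / r₀) * ‖y‖ ^ 2 := by
  have hρ : ‖y‖ ≠ 0 := norm_ne_zero_iff.2 hy
  rw [firstOrderH_apply, triple_self_right, real_inner_self_eq_norm_sq]
  field_simp
  ring

/-- `Σᵢ fH(eᵢ, eᵢ) = δm (2/r₀)`. [cite: LiMei2020, p. 25] -/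
theorem sum_firstOrderH_apply_single (M r₀ : ℝ) (p : ℝ × E3) {y : E3} (hy : y ≠ 0) :
    ∑ i, firstOrderH M r₀ p y (EuclideanSpace.single i 1) (EuclideanSpace.single i 1) =
      p.1 * (2 / r₀) := by
  have hρ : ‖y‖ ≠ 0 := norm_ne_zero_iff.2 hy
  calc ∑ i, firstOrderH M r₀ p y (EuclideanSpace.single i 1) (EuclideanSpace.single i 1)
      = ∑ i, (p.1 * (2 / r₀) / ‖y‖ ^ 2 * y i ^ 2 -
          2 * (2 * M / (r₀ * ‖y‖ ^ 3)) * (y i * triple p.2 y (EuclideanSpace.single i 1))) := by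
        refine Finset.sum_congr rfl fun i _ ↦ ?_
        rw [firstOrderH_apply, inner_single_one_right]
        ring
    _ = p.1 * (2 / r₀) / ‖y‖ ^ 2 * ∑ i, y i ^ 2 -
          2 * (2 * M / (r₀ * ‖y‖ ^ 3)) * ∑ i, y i * triple p.2 y (EuclideanSpace.single i 1) := by
        rw [Finset.sum_sub_distrib, Finset.mul_sum, Finset.mul_sum]
    _ = p.1 * (2 / r₀) := by
        rw [sum_coord_sq, sum_coord_mul_triple_single, mul_zero, sub_zero]
        field_simp

/-- **`T(firstOrderH) = 0`**: the trace defect `Σᵢ β(eᵢ,eᵢ) − β(y,y)/ρ²` of the first-order metric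
variation vanishes (it is pure `dt²` plus an off-diagonal spin term). [cite: LiMei2020, p. 25] -/
theorem traceDefect_firstOrderH (M r₀ : ℝ) (p : ℝ × E3) {y : E3} (hy : y ≠ 0) :
    ∑ i, firstOrderH M r₀ p y (EuclideanSpace.single i 1) (EuclideanSpace.single i 1) -
        firstOrderH M r₀ p y y y / ‖y‖ ^ 2 = 0 := by
  have hρ : ‖y‖ ≠ 0 := norm_ne_zero_iff.2 hy
  rw [sum_firstOrderH_apply_single M r₀ p hy, firstOrderH_apply_self M r₀ p hy]
  field_simp
  ring

/-- `fK(y, y) = δm (√A/r₀² + M/(r₀³√A)) ρ²`. [cite: LiMei2020, p. 25] -/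
theorem firstOrderK_apply_self (M r₀ : ℝ) (p : ℝ × E3) {y : E3} (hy : y ≠ 0) :
    firstOrderK M r₀ p y y y =
      p.1 * (Real.sqrt (2 * M / r₀ - 1) / r₀ ^ 2 + M / (r₀ ^ 3 * Real.sqrt (2 * M / r₀ - 1))) *
        ‖y‖ ^ 2 := by
  have hρ : ‖y‖ ≠ 0 := norm_ne_zero_iff.2 hy
  rw [firstOrderK_apply, triple_self_right, real_inner_self_eq_norm_sq]
  field_simp
  ring

/-- `Σᵢ fK(eᵢ, eᵢ) = δm (√A/r₀² + M/(r₀³√A) − 2/(√Aρ²))`. [cite: LiMei2020, p. 25] -/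
theorem sum_firstOrderK_apply_single (M r₀ : ℝ) (p : ℝ × E3) {y : E3} (hy : y ≠ 0) :
    ∑ i, firstOrderK M r₀ p y (EuclideanSpace.single i 1) (EuclideanSpace.single i 1) =
      p.1 * (Real.sqrt (2 * M / r₀ - 1) / r₀ ^ 2 + M / (r₀ ^ 3 * Real.sqrt (2 * M / r₀ - 1)) -
        2 / (Real.sqrt (2 * M / r₀ - 1) * ‖y‖ ^ 2)) := by
  have hρ : ‖y‖ ≠ 0 := norm_ne_zero_iff.2 hy
  set s := Real.sqrt (2 * M / r₀ - 1) with hs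
  calc ∑ i, firstOrderK M r₀ p y (EuclideanSpace.single i 1) (EuclideanSpace.single i 1)
      = ∑ i, (p.1 * ((s / r₀ ^ 2 + M / (r₀ ^ 3 * s)) / ‖y‖ ^ 2 + 1 / (s * ‖y‖ ^ 2) / ‖y‖ ^ 2) *
            y i ^ 2 -
          2 * (M * s / (r₀ ^ 2 * ‖y‖ ^ 3)) * (y i * triple p.2 y (EuclideanSpace.single i 1)) +
          -(p.1 * (1 / (s * ‖y‖ ^ 2)))) := by
        refine Finset.sum_congr rfl fun i _ ↦ ?_
        rw [firstOrderK_apply, inner_single_one_right, inner_single_one_self]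
        ring
    _ = p.1 * ((s / r₀ ^ 2 + M / (r₀ ^ 3 * s)) / ‖y‖ ^ 2 + 1 / (s * ‖y‖ ^ 2) / ‖y‖ ^ 2) *
            ∑ i, y i ^ 2 -
          2 * (M * s / (r₀ ^ 2 * ‖y‖ ^ 3)) * ∑ i, y i * triple p.2 y (EuclideanSpace.single i 1) +
          ∑ _i : Fin 3, -(p.1 * (1 / (s * ‖y‖ ^ 2))) := by
        rw [Finset.sum_add_distrib, Finset.sum_sub_distrib, Finset.mul_sum, Finset.mul_sum]
    _ = p.1 * (s / r₀ ^ 2 + M / (r₀ ^ 3 * s) - 2 / (s * ‖y‖ ^ 2)) := by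
        rw [sum_coord_sq, sum_coord_mul_triple_single, mul_zero, sub_zero, Finset.sum_const,
          Finset.card_univ, Fintype.card_fin]
        simp only [nsmul_eq_mul, Nat.cast_ofNat]
        field_simp
        ring

/-- **`T(firstOrderK) = −2 δm/(√A ρ²)`**: the trace defect of the first-order variation of the
second fundamental form. [cite: LiMei2020, p. 25] -/
theorem traceDefect_firstOrderK (M r₀ : ℝ) (p : ℝ × E3) {y : E3} (hy : y ≠ 0) :
    ∑ i, firstOrderK M r₀ p y (EuclideanSpace.single i 1) (EuclideanSpace.single i 1) -
        firstOrderK M r₀ p y y y / ‖y‖ ^ 2 =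
      -(2 * p.1) / (Real.sqrt (2 * M / r₀ - 1) * ‖y‖ ^ 2) := by
  have hρ : ‖y‖ ≠ 0 := norm_ne_zero_iff.2 hy
  rw [sum_firstOrderK_apply_single M r₀ p hy, firstOrderK_apply_self M r₀ p hy]
  field_simp
  ring

/-- **`fH(Ωy, y) = −(2M/(r₀ρ)) b·(y × Ωy)`** for a skew `Ω`. [cite: LiMei2020, p. 25] -/
theorem firstOrderH_apply_skew_self (M r₀ : ℝ) (p : ℝ × E3) (Ω : E3 →L[ℝ] E3)
    (hΩ : ∀ u u' : E3, ⟪Ω u, u'⟫ = -⟪u, Ω u'⟫) {y : E3} (hy : y ≠ 0) :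
    firstOrderH M r₀ p y (Ω y) y = -(2 * M / (r₀ * ‖y‖)) * triple p.2 y (Ω y) := by
  have hρ : ‖y‖ ≠ 0 := norm_ne_zero_iff.2 hy
  rw [firstOrderH_apply, inner_skew_self Ω hΩ y, triple_self_right,
    real_inner_self_eq_norm_sq]
  field_simp
  ring

/-- **`fK(Ωy, y) = −(M√A/(r₀²ρ)) b·(y × Ωy)`** for a skew `Ω`. [cite: LiMei2020, p. 25] -/
theorem firstOrderK_apply_skew_self (M : ℝ) {r₀ : ℝ} (hr₀ : 0 < r₀) (p : ℝ × E3)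
    (Ω : E3 →L[ℝ] E3) (hΩ : ∀ u u' : E3, ⟪Ω u, u'⟫ = -⟪u, Ω u'⟫) {y : E3} (hy : y ≠ 0) :
    firstOrderK M r₀ p y (Ω y) y =
      -(M * Real.sqrt (2 * M / r₀ - 1) / (r₀ ^ 2 * ‖y‖)) * triple p.2 y (Ω y) := by
  have hρ : ‖y‖ ≠ 0 := norm_ne_zero_iff.2 hy
  have hr : r₀ ≠ 0 := hr₀.ne'
  have h0 : ⟪Ω y, y⟫ = 0 := by rw [real_inner_comm]; exact inner_skew_self Ω hΩ y
  rw [firstOrderK_apply, inner_skew_self Ω hΩ y, h0, triple_self_right,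
    real_inner_self_eq_norm_sq]
  simp only [zero_mul, mul_zero, zero_div, sub_zero, add_zero]
  set s := Real.sqrt (2 * M / r₀ - 1) with hs_def
  field_simp
  ring

/-- **The `∂_t`-integrand of the first-order obstruction is `−2 δm χ₀'(ρ)/ρ²`**:
`√g₀ (⟨fH, DM*_γ(χ∂_t)⟩ + ⟨fK, DM*_κ(χ∂_t)⟩)` with the paired commutators of
`SchwarzschildCylinderCommutators` (`√g₀ = √A r₀²/ρ²`). [cite: LiMei2020, proof of Prop. 4.1, p. 25] -/
theorem timeIntegrand_firstOrder_eq {M r₀ : ℝ} (hr₀ : 0 < r₀) (h2M : r₀ < 2 * M) (p : ℝ × E3)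
    (χ₀ : ℝ → ℝ) (y : E3) :
    Real.sqrt (2 * M / r₀ - 1) * r₀ ^ 2 / ‖y‖ ^ 2 *
        (deriv χ₀ ‖y‖ * ((M - r₀) / (2 * r₀ ^ 2 * Real.sqrt (2 * M / r₀ - 1))) * (‖y‖ ^ 2 / r₀ ^ 2) *
            (∑ i, firstOrderH M r₀ p y (EuclideanSpace.single i 1) (EuclideanSpace.single i 1) -
              firstOrderH M r₀ p y y y / ‖y‖ ^ 2) +
          deriv χ₀ ‖y‖ * (‖y‖ ^ 2 / r₀ ^ 2) *
            (∑ i, firstOrderK M r₀ p y (EuclideanSpace.single i 1) (EuclideanSpace.single i 1) -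
              firstOrderK M r₀ p y y y / ‖y‖ ^ 2)) =
      -(2 * p.1) * (deriv χ₀ ‖y‖ / ‖y‖ ^ 2) := by
  by_cases hy : y = 0
  · subst hy; simp
  have hρ : ‖y‖ ≠ 0 := norm_ne_zero_iff.2 hy
  have hr : r₀ ≠ 0 := hr₀.ne'
  rw [traceDefect_firstOrderH M r₀ p hy, traceDefect_firstOrderK M r₀ p hy]
  set s := Real.sqrt (2 * M / r₀ - 1) with hs_def
  have hs : s ≠ 0 := (Real.sqrt_pos.2 (lapse_pos hr₀ h2M)).ne'
  field_simp
  ring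

/-- **The `Ω_ω`-integrand of the first-order obstruction is `3M χ₀'(ρ)/ρ² (⟨b,ω⟩ − ⟨b,ŷ⟩⟨ŷ,ω⟩)`**:
`√g₀ (⟨fH, DM*_γ(χΩ_ω)⟩ + ⟨fK, DM*_κ(χΩ_ω)⟩)` with the paired commutators of
`SchwarzschildCylinderCommutators`. [cite: LiMei2020, proof of Prop. 4.1, p. 25] -/
theorem rotIntegrand_firstOrder_eq {M r₀ : ℝ} (hr₀ : 0 < r₀) (h2M : r₀ < 2 * M) (p : ℝ × E3)
    (χ₀ : ℝ → ℝ) (ω y : E3) :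
    Real.sqrt (2 * M / r₀ - 1) * r₀ ^ 2 / ‖y‖ ^ 2 *
        (-(deriv χ₀ ‖y‖ / (r₀ * Real.sqrt (2 * M / r₀ - 1) * ‖y‖)) *
            firstOrderH M r₀ p y (crossCLM ω y) y +
          -(deriv χ₀ ‖y‖ / (‖y‖ * (2 * M / r₀ - 1))) * firstOrderK M r₀ p y (crossCLM ω y) y) =
      3 * M * (deriv χ₀ ‖y‖ / ‖y‖ ^ 2) * ⟪p.2, ω⟫ -
        3 * M * (deriv χ₀ ‖y‖ / ‖y‖ ^ 2 * (⟪p.2, ‖y‖⁻¹ • y⟫ * ⟪‖y‖⁻¹ • y, ω⟫)) := by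
  by_cases hy : y = 0
  · subst hy; simp
  have hρ : ‖y‖ ≠ 0 := norm_ne_zero_iff.2 hy
  have hA := lapse_pos hr₀ h2M
  have hr : r₀ ≠ 0 := hr₀.ne'
  rw [firstOrderH_apply_skew_self M r₀ p (crossCLM ω) (inner_crossCLM_skew ω) hy,
    firstOrderK_apply_skew_self M hr₀ p (crossCLM ω) (inner_crossCLM_skew ω) hy, crossCLM_apply,
    triple_crossVec_self, real_inner_smul_right, real_inner_smul_left]
  set s := Real.sqrt (2 * M / r₀ - 1) with hs_def
  have hs : s ≠ 0 := (Real.sqrt_pos.2 hA).ne'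
  have hs2 : 2 * M / r₀ - 1 = s ^ 2 := (Real.sq_sqrt hA.le).symm
  rw [hs2]
  field_simp
  ring

/-! ### Radial integration on `E3` and the cut-off profile -/

/-- **`∫_{E3} f(‖y‖)/‖y‖² dy = 4π ∫₀^∞ f`** (polar coordinates, `|B₁| = 4π/3`). [folklore] -/
theorem integral_fun_norm_div_norm_sq (f : ℝ → ℝ) :
    ∫ y : E3, f ‖y‖ / ‖y‖ ^ 2 = 4 * π * ∫ r in Ioi (0 : ℝ), f r := by
  have h := integral_fun_norm_addHaar (volume : Measure E3) (fun r : ℝ ↦ f r / r ^ 2)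
  simp only [finrank_euclideanSpace_fin] at h
  have h3 : ∫ r in Ioi (0 : ℝ), r ^ (3 - 1) • (f r / r ^ 2) = ∫ r in Ioi (0 : ℝ), f r := by
    refine setIntegral_congr_fun measurableSet_Ioi fun r hr ↦ ?_
    have hr0 : r ≠ 0 := ne_of_gt hr
    show r ^ 2 * (f r / r ^ 2) = f r
    rw [← mul_div_assoc, mul_div_cancel_left₀ _ (pow_ne_zero 2 hr0)]
  change ∫ y : E3, (fun r : ℝ ↦ f r / r ^ 2) ‖y‖ = _
  rw [h, h3, measureReal_def, EuclideanSpace.volume_ball_fin_three, ENNReal.toReal_mul,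
    ← ENNReal.ofReal_pow zero_le_one, one_pow, ENNReal.toReal_ofReal zero_le_one,
    ENNReal.toReal_ofReal (by positivity : (0 : ℝ) ≤ π * 4 / 3)]
  simp only [nsmul_eq_mul, smul_eq_mul]
  push_cast
  ring

/-- `y ↦ f(‖y‖)/‖y‖²` is integrable on `E3` when `f` is integrable on `(0, ∞)`. [folklore] -/
theorem integrable_fun_norm_div_norm_sq {f : ℝ → ℝ} (hf : IntegrableOn f (Ioi 0)) :
    Integrable (fun y : E3 ↦ f ‖y‖ / ‖y‖ ^ 2) := by
  have h := (integrable_fun_norm_addHaar (volume : Measure E3) (f := fun r : ℝ ↦ f r / r ^ 2)).2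
  rw [finrank_euclideanSpace_fin] at h
  refine h (hf.congr_fun (fun r hr ↦ ?_) measurableSet_Ioi)
  have hr0 : r ≠ 0 := ne_of_gt hr
  show f r = r ^ 2 * (f r / r ^ 2)
  rw [← mul_div_assoc, mul_div_cancel_left₀ _ (pow_ne_zero 2 hr0)]

section Profile

variable {χ₀ : ℝ → ℝ} {s₁ s₂ : ℝ}

/-- The derivative of a profile equal to `1` on `|r| ≤ s₁` vanishes on `|r| < s₁`. [folklore] -/
theorem deriv_cutoffProfile_eq_zero_of_abs_lt (h1 : ∀ r, |r| ≤ s₁ → χ₀ r = 1) {r : ℝ}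
    (hr : |r| < s₁) : deriv χ₀ r = 0 := by
  have h : χ₀ =ᶠ[𝓝 r] fun _ ↦ (1 : ℝ) :=
    Filter.eventually_of_mem ((isOpen_lt continuous_abs continuous_const).mem_nhds hr)
      fun x hx ↦ h1 x (le_of_lt hx)
  rw [h.deriv_eq, deriv_const]

/-- The derivative of a profile equal to `0` on `s₂ ≤ |r|` vanishes on `s₂ < |r|`. [folklore] -/
theorem deriv_cutoffProfile_eq_zero_of_lt_abs (h0 : ∀ r, s₂ ≤ |r| → χ₀ r = 0) {r : ℝ}
    (hr : s₂ < |r|) : deriv χ₀ r = 0 := by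
  have h : χ₀ =ᶠ[𝓝 r] fun _ ↦ (0 : ℝ) :=
    Filter.eventually_of_mem ((isOpen_lt continuous_const continuous_abs).mem_nhds hr)
      fun x hx ↦ h0 x (le_of_lt hx)
  rw [h.deriv_eq, deriv_const]

/-- The derivative of such a profile has compact support. [folklore] -/
theorem hasCompactSupport_deriv_cutoffProfile (h0 : ∀ r, s₂ ≤ |r| → χ₀ r = 0) :
    HasCompactSupport (deriv χ₀) := by
  refine HasCompactSupport.intro (K := Icc (-(|s₂| + 1)) (|s₂| + 1)) isCompact_Icc fun r hr ↦ ?_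
  apply deriv_cutoffProfile_eq_zero_of_lt_abs h0
  rw [mem_Icc, not_and_or, not_le, not_le] at hr
  have hT : |s₂| + 1 < |r| := by
    rcases hr with hr | hr
    · linarith [neg_le_abs r]
    · linarith [le_abs_self r]
  linarith [le_abs_self s₂]

/-- The derivative of a `C¹` profile of this kind is integrable. [folklore] -/
theorem integrable_deriv_cutoffProfile (hχ : ContDiff ℝ 1 χ₀) (h0 : ∀ r, s₂ ≤ |r| → χ₀ r = 0) :
    Integrable (deriv χ₀) :=
  (hχ.continuous_deriv le_rfl).integrable_of_hasCompactSupport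
    (hasCompactSupport_deriv_cutoffProfile h0)

/-- **`∫₀^∞ χ₀' = −1`** for a `C¹` profile equal to `1` on `|r| ≤ s₁` (`s₁ ≥ 0`) and to `0` on
`s₂ ≤ |r|`. [folklore] -/
theorem integral_Ioi_deriv_cutoffProfile (hχ : ContDiff ℝ 1 χ₀) (hs₁ : 0 ≤ s₁)
    (h1 : ∀ r, |r| ≤ s₁ → χ₀ r = 1) (h0 : ∀ r, s₂ ≤ |r| → χ₀ r = 0) :
    ∫ r in Ioi (0 : ℝ), deriv χ₀ r = -1 := by
  have hd : Differentiable ℝ χ₀ := hχ.differentiable one_ne_zero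
  have htend : Tendsto χ₀ atTop (𝓝 0) := by
    refine tendsto_const_nhds.congr' ?_
    filter_upwards [Filter.eventually_ge_atTop s₂] with r hr
    exact (h0 r (hr.trans (le_abs_self r))).symm
  rw [integral_Ioi_of_hasDerivAt_of_tendsto hχ.continuous.continuousWithinAt
      (fun x _ ↦ (hd x).hasDerivAt) (integrable_deriv_cutoffProfile hχ h0).integrableOn htend,
    h1 0 (by rw [abs_zero]; exact hs₁)]
  norm_num

/-- **`∫_{E3} χ₀'(‖y‖)/‖y‖² dy = −4π`**. [folklore] -/
theorem integral_deriv_cutoffProfile_norm_div (hχ : ContDiff ℝ 1 χ₀) (hs₁ : 0 ≤ s₁)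
    (h1 : ∀ r, |r| ≤ s₁ → χ₀ r = 1) (h0 : ∀ r, s₂ ≤ |r| → χ₀ r = 0) :
    ∫ y : E3, deriv χ₀ ‖y‖ / ‖y‖ ^ 2 = -(4 * π) := by
  rw [integral_fun_norm_div_norm_sq, integral_Ioi_deriv_cutoffProfile hχ hs₁ h1 h0]
  ring

/-- `y ↦ χ₀'(‖y‖)/‖y‖²` is integrable on `E3`. [folklore] -/
theorem integrable_deriv_cutoffProfile_norm_div (hχ : ContDiff ℝ 1 χ₀)
    (h0 : ∀ r, s₂ ≤ |r| → χ₀ r = 0) :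
    Integrable (fun y : E3 ↦ deriv χ₀ ‖y‖ / ‖y‖ ^ 2) :=
  integrable_fun_norm_div_norm_sq (integrable_deriv_cutoffProfile hχ h0).integrableOn

/-- `‖ŷ‖ ≤ 1` for `ŷ = ‖y‖⁻¹ y`. [folklore] -/
theorem norm_unitDir_le_one (y : E3) : ‖‖y‖⁻¹ • y‖ ≤ 1 := by
  rcases eq_or_ne y 0 with rfl | hy
  · simp
  · rw [norm_smul, norm_inv, norm_norm, inv_mul_cancel₀ (norm_ne_zero_iff.2 hy)]

/-- `y ↦ ⟨b, ŷ⟩⟨ŷ, ω⟩` is measurable. [folklore] -/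
theorem measurable_inner_unitDir_mul (b ω : E3) :
    Measurable fun y : E3 ↦ ⟪b, ‖y‖⁻¹ • y⟫ * ⟪‖y‖⁻¹ • y, ω⟫ := by
  have hu : Measurable fun y : E3 ↦ ‖y‖⁻¹ • y := measurable_norm.inv.smul measurable_id
  exact (measurable_const.inner hu).mul (hu.inner measurable_const)

/-- `|⟨b, ŷ⟩⟨ŷ, ω⟩| ≤ ‖b‖ ‖ω‖`. [folklore] -/
theorem abs_inner_unitDir_mul_le (b ω y : E3) :
    ‖⟪b, ‖y‖⁻¹ • y⟫ * ⟪‖y‖⁻¹ • y, ω⟫‖ ≤ ‖b‖ * ‖ω‖ := by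
  have hu := norm_unitDir_le_one y
  rw [norm_mul, Real.norm_eq_abs, Real.norm_eq_abs]
  have h1 : |⟪b, ‖y‖⁻¹ • y⟫| ≤ ‖b‖ :=
    (abs_real_inner_le_norm _ _).trans (mul_le_of_le_one_right (norm_nonneg _) hu)
  have h2 : |⟪‖y‖⁻¹ • y, ω⟫| ≤ ‖ω‖ :=
    (abs_real_inner_le_norm _ _).trans (mul_le_of_le_one_left (norm_nonneg _) hu)
  exact mul_le_mul h1 h2 (abs_nonneg _) (norm_nonneg _)

/-- **`∫_{E3} (χ₀'(‖y‖)/‖y‖²) ⟨b, ŷ⟩⟨ŷ, ω⟩ dy = −(4π/3)⟨b, ω⟩`** (angular average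
`∫ k(‖y‖) ŷ⊗ŷ = ⅓ (∫ k) 1`). [cite: Eyink2003, §2 (third-delta)] -/
theorem integral_deriv_cutoffProfile_norm_div_mul_inner (hχ : ContDiff ℝ 1 χ₀) (hs₁ : 0 ≤ s₁)
    (h1 : ∀ r, |r| ≤ s₁ → χ₀ r = 1) (h0 : ∀ r, s₂ ≤ |r| → χ₀ r = 0) (b ω : E3) :
    ∫ y : E3, deriv χ₀ ‖y‖ / ‖y‖ ^ 2 * (⟪b, ‖y‖⁻¹ • y⟫ * ⟪‖y‖⁻¹ • y, ω⟫) =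
      -(4 * π / 3) * ⟪b, ω⟫ := by
  rw [Literature.Analysis.FluidPDE.Torus.integral_radial_mul_inner_unit_mul_inner_unit
      (integrable_deriv_cutoffProfile_norm_div hχ h0) (fun x y h ↦ by rw [h]) b ω,
    integral_deriv_cutoffProfile_norm_div hχ hs₁ h1 h0, Fintype.card_fin]
  push_cast
  ring

end Profile

/-- **The radial profile of the tree's cut-off**: `radialCutoff s₁ s₂ y = radialCutoff s₁ s₂ ‖y‖`,
the right-hand side being the same cut-off on the real line. [folklore] -/
theorem radialCutoff_eq_radialCutoff_norm (s₁ s₂ : ℝ) (y : E3) :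
    radialCutoff s₁ s₂ y = radialCutoff s₁ s₂ ‖y‖ := by
  simp only [radialCutoff, Real.norm_eq_abs, sq_abs]

/-- The real-line profile is `1` on `|r| ≤ s₁` (`0 ≤ s₁ < s₂`). [folklore] -/
theorem radialCutoff_real_of_abs_le {s₁ s₂ : ℝ} (hs₁ : 0 ≤ s₁) (h₁₂ : s₁ < s₂) (r : ℝ)
    (hr : |r| ≤ s₁) : radialCutoff s₁ s₂ r = 1 :=
  radialCutoff_of_norm_le hs₁ h₁₂ (by rwa [Real.norm_eq_abs])

/-- The real-line profile is `0` on `s₂ ≤ |r|` (`0 ≤ s₁ < s₂`). [folklore] -/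
theorem radialCutoff_real_of_le_abs {s₁ s₂ : ℝ} (hs₁ : 0 ≤ s₁) (h₁₂ : s₁ < s₂) (r : ℝ)
    (hr : s₂ ≤ |r|) : radialCutoff s₁ s₂ r = 0 :=
  radialCutoff_of_le_norm hs₁ h₁₂ (by rwa [Real.norm_eq_abs])

/-- The real-line profile is `C¹`. [folklore] -/
theorem contDiff_one_radialCutoff_real (s₁ s₂ : ℝ) : ContDiff ℝ 1 (radialCutoff s₁ s₂ : ℝ → ℝ) :=
  (contDiff_radialCutoff s₁ s₂).of_le (by exact_mod_cast le_top)

/-! ### The two obstruction integrals -/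

/-- **`∫ (∂_t-integrand of the first-order obstruction) = 8π δm`** (Li–Mei p. 25: the first
component of `𝓘` is `8π(m − m₀)` to first order). [cite: LiMei2020, proof of Prop. 4.1, p. 25] -/
theorem integral_timeIntegrand_firstOrder {M r₀ : ℝ} (hr₀ : 0 < r₀) (h2M : r₀ < 2 * M)
    (p : ℝ × E3) {χ₀ : ℝ → ℝ} {s₁ s₂ : ℝ} (hχ : ContDiff ℝ 1 χ₀) (hs₁ : 0 ≤ s₁)
    (h1 : ∀ r, |r| ≤ s₁ → χ₀ r = 1) (h0 : ∀ r, s₂ ≤ |r| → χ₀ r = 0) :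
    ∫ y : E3, Real.sqrt (2 * M / r₀ - 1) * r₀ ^ 2 / ‖y‖ ^ 2 *
        (deriv χ₀ ‖y‖ * ((M - r₀) / (2 * r₀ ^ 2 * Real.sqrt (2 * M / r₀ - 1))) * (‖y‖ ^ 2 / r₀ ^ 2) *
            (∑ i, firstOrderH M r₀ p y (EuclideanSpace.single i 1) (EuclideanSpace.single i 1) -
              firstOrderH M r₀ p y y y / ‖y‖ ^ 2) +
          deriv χ₀ ‖y‖ * (‖y‖ ^ 2 / r₀ ^ 2) *
            (∑ i, firstOrderK M r₀ p y (EuclideanSpace.single i 1) (EuclideanSpace.single i 1) -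
              firstOrderK M r₀ p y y y / ‖y‖ ^ 2)) = 8 * π * p.1 := by
  rw [integral_congr_ae (ae_of_all _ (timeIntegrand_firstOrder_eq hr₀ h2M p χ₀)),
    integral_const_mul, integral_deriv_cutoffProfile_norm_div hχ hs₁ h1 h0]
  ring

/-- **`∫ (Ω_ω-integrand of the first-order obstruction) = −8πM ⟨b, ω⟩`** (Li–Mei p. 25: the
rotational components of `𝓘` are `−8π m₀ a⃗` to first order). [cite: LiMei2020, proof of Prop. 4.1, p. 25] -/
theorem integral_rotIntegrand_firstOrder {M r₀ : ℝ} (hr₀ : 0 < r₀) (h2M : r₀ < 2 * M)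
    (p : ℝ × E3) {χ₀ : ℝ → ℝ} {s₁ s₂ : ℝ} (hχ : ContDiff ℝ 1 χ₀) (hs₁ : 0 ≤ s₁)
    (h1 : ∀ r, |r| ≤ s₁ → χ₀ r = 1) (h0 : ∀ r, s₂ ≤ |r| → χ₀ r = 0) (ω : E3) :
    ∫ y : E3, Real.sqrt (2 * M / r₀ - 1) * r₀ ^ 2 / ‖y‖ ^ 2 *
        (-(deriv χ₀ ‖y‖ / (r₀ * Real.sqrt (2 * M / r₀ - 1) * ‖y‖)) *
            firstOrderH M r₀ p y (crossCLM ω y) y +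
          -(deriv χ₀ ‖y‖ / (‖y‖ * (2 * M / r₀ - 1))) * firstOrderK M r₀ p y (crossCLM ω y) y) =
      -(8 * π * M) * ⟪p.2, ω⟫ := by
  have hk := integrable_deriv_cutoffProfile_norm_div (χ₀ := χ₀) hχ h0
  have hF : Integrable fun y : E3 ↦ 3 * M * (deriv χ₀ ‖y‖ / ‖y‖ ^ 2) * ⟪p.2, ω⟫ :=
    (hk.const_mul _).mul_const _
  have hG : Integrable fun y : E3 ↦
      3 * M * (deriv χ₀ ‖y‖ / ‖y‖ ^ 2 * (⟪p.2, ‖y‖⁻¹ • y⟫ * ⟪‖y‖⁻¹ • y, ω⟫)) :=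
    (hk.mul_bdd (measurable_inner_unitDir_mul p.2 ω).aestronglyMeasurable
      (ae_of_all _ (abs_inner_unitDir_mul_le p.2 ω))).const_mul _
  rw [integral_congr_ae (ae_of_all _ (rotIntegrand_firstOrder_eq hr₀ h2M p χ₀ ω)),
    integral_sub hF hG, integral_mul_const, integral_const_mul, integral_const_mul,
    integral_deriv_cutoffProfile_norm_div_mul_inner hχ hs₁ h1 h0,
    integral_deriv_cutoffProfile_norm_div hχ hs₁ h1 h0]
  ring

/-- **The first-order obstruction is `L = obstructionLinear M`**: its `∂_t`-component is the time
integral and its `Ω_ω`-components are the rotation integrals (Li–Mei p. 25,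
`𝓘 = (8π(m − m₀), −8π m₀ a⃗) + …`). [cite: LiMei2020, proof of Prop. 4.1, p. 25] -/
theorem obstructionLinear_eq_integrals {M r₀ : ℝ} (hr₀ : 0 < r₀) (h2M : r₀ < 2 * M)
    (p : ℝ × E3) {χ₀ : ℝ → ℝ} {s₁ s₂ : ℝ} (hχ : ContDiff ℝ 1 χ₀) (hs₁ : 0 ≤ s₁)
    (h1 : ∀ r, |r| ≤ s₁ → χ₀ r = 1) (h0 : ∀ r, s₂ ≤ |r| → χ₀ r = 0) (ω : E3) :
    (obstructionLinear M p).1 =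
        ∫ y : E3, Real.sqrt (2 * M / r₀ - 1) * r₀ ^ 2 / ‖y‖ ^ 2 *
          (deriv χ₀ ‖y‖ * ((M - r₀) / (2 * r₀ ^ 2 * Real.sqrt (2 * M / r₀ - 1))) *
              (‖y‖ ^ 2 / r₀ ^ 2) *
              (∑ i, firstOrderH M r₀ p y (EuclideanSpace.single i 1) (EuclideanSpace.single i 1) -
                firstOrderH M r₀ p y y y / ‖y‖ ^ 2) +
            deriv χ₀ ‖y‖ * (‖y‖ ^ 2 / r₀ ^ 2) *
              (∑ i, firstOrderK M r₀ p y (EuclideanSpace.single i 1) (EuclideanSpace.single i 1) -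
                firstOrderK M r₀ p y y y / ‖y‖ ^ 2)) ∧
      ⟪(obstructionLinear M p).2, ω⟫ =
        ∫ y : E3, Real.sqrt (2 * M / r₀ - 1) * r₀ ^ 2 / ‖y‖ ^ 2 *
          (-(deriv χ₀ ‖y‖ / (r₀ * Real.sqrt (2 * M / r₀ - 1) * ‖y‖)) *
              firstOrderH M r₀ p y (crossCLM ω y) y +
            -(deriv χ₀ ‖y‖ / (‖y‖ * (2 * M / r₀ - 1))) * firstOrderK M r₀ p y (crossCLM ω y) y) := by
  rw [integral_timeIntegrand_firstOrder hr₀ h2M p hχ hs₁ h1 h0,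
    integral_rotIntegrand_firstOrder hr₀ h2M p hχ hs₁ h1 h0 ω, obstructionLinear_apply,
    real_inner_smul_left]
  exact ⟨rfl, rfl⟩

end LiMei

end Literature.Geometry.Lorentzian

end
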